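import Literature.Analysis.PDE.Transfer
import HarnessLib

/-!
# A calculus of sup/`L²`-controlled smooth maps (tame product and composition estimates)

Estimate layer of the energy-method programme for short-time existence of quasilinear strictly
parabolic second-order systems on a closed manifold (hypothesis `hQL` of
`Literature.Geometry.Riemannian.ricciFlow_shortTime_existence_of_quasilinear`). Gårding's
inequality for the localised operator (`Garding.lean`) is an exercise in the Moser-type "tame"
calculus: every coefficient is a product/composition of maps each of which has (i) uniformly
bounded coordinate-word derivatives up to a middle order `q` on a compact set `K`, and
(ii) `L²(K)`-bounded word derivatives up to the top order `m`, and such control is inherited by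
sums, continuous bilinear images, compositions with smooth maps of the jet (the tame estimate
`exists_tame_bound_cwd_comp` of `CoordWordTame.lean`) and chart transfers (`Transfer.lean`).
This file packages the two controls as one predicate and proves the inheritance rules:

* `Ctrl K q m A Y g` — `g` is smooth, `‖∂_c g‖ ≤ A` on `K` for `|c| ≤ q`, and
  `‖∂_c g‖_{L²(K)} ≤ Y` for `|c| ≤ m`;
* `Ctrl.mono`, `Ctrl.cwd_right`, `Ctrl.add`, `Ctrl.sub`, `Ctrl.sum`, `Ctrl.const`,
  `Ctrl.clm_comp`, `exists_ctrl_of_hasCompactSupport`;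
* `Ctrl.bilinear`, `Ctrl.smul` — **tame product estimate** (`m ≤ 2q + 1`): in every Leibniz term
  one factor carries at most `q` derivatives and is put in sup norm
  [cite: TaylorPDEIII2011, Ch. 13, §3, Prop. 3.6–3.7];
* `l2On_cwd_smul_sub_le` — **commutator estimate** `‖∂_v(a g) - a ∂_v g‖_{L²(K)}` with one
  derivative fewer on `g` [cite: TaylorPDEIII2011, Ch. 13, §3, Prop. 3.7 (3.6.21)];
* `exists_ctrl_comp` — **tame composition estimate** `Ctrl K q m A Y h → Ctrl K q m C (C(1+Y)) (F ∘ (id, h))`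
  for smooth `F`, `m/2 + 1 ≤ q` [cite: TaylorPDEIII2011, Ch. 13, §3, Prop. 3.9];
* `TransferData.exists_ctrl_transfer` — control of chart transfers.

Everything is proved; no named fact and no `sorry` is introduced.

## References

* M. E. Taylor, *Partial differential equations III*, 2nd ed., Springer 2011, Ch. 13, §3
  (Moser estimates). [TaylorPDEIII2011]
* L. C. Evans, *Partial differential equations*, 2nd ed., AMS 2010, §5.6, App. C.2. [Evans2010]
-/

noncomputable section

open MeasureTheory Set Function Filter Metric
open scoped ContDiff Topology ENNReal NNReal

namespace Literature.Analysis.PDE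

universe u v

variable {ι : Type*} [Fintype ι] [DecidableEq ι]
variable {F : Type*} [NormedAddCommGroup F] [NormedSpace ℝ F]
variable {F₁ : Type*} [NormedAddCommGroup F₁] [NormedSpace ℝ F₁]
variable {F₂ : Type*} [NormedAddCommGroup F₂] [NormedSpace ℝ F₂]
variable {F₃ : Type*} [NormedAddCommGroup F₃] [NormedSpace ℝ F₃]

/-! ### More `l2On` inequalities -/

omit [DecidableEq ι] [NormedSpace ℝ F] in
/-- `l2On` only sees the norm. [folklore] -/
theorem l2On_norm (K : Set (EuclideanSpace ℝ ι)) (f : EuclideanSpace ℝ ι → F) :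
    l2On K (fun x => ‖f x‖) = l2On K f := by
  rw [l2On_def, l2On_def, ← eLpNorm_norm (K.indicator f)]
  have h : (K.indicator fun x => ‖f x‖) = fun x => ‖K.indicator f x‖ := by
    funext x
    rw [norm_indicator_eq_indicator_norm]
  rw [h]

omit [DecidableEq ι] [NormedSpace ℝ F] in
/-- `l2On K 0 = 0`. [folklore] -/
@[simp]
theorem l2On_zero (K : Set (EuclideanSpace ℝ ι)) : l2On K (fun _ : EuclideanSpace ℝ ι => (0 : F)) = 0 := by
  rw [l2On_def]
  simp

omit [DecidableEq ι] [NormedSpace ℝ F] in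
/-- `l2On K f ≤ ‖f‖_{L²}`. [folklore] -/
theorem l2On_le_eLpNorm_toReal (K : Set (EuclideanSpace ℝ ι)) {f : EuclideanSpace ℝ ι → F}
    (hf : eLpNorm f 2 (volume : Measure (EuclideanSpace ℝ ι)) ≠ ⊤) :
    l2On K f ≤ (eLpNorm f 2 (volume : Measure (EuclideanSpace ℝ ι))).toReal := by
  rw [l2On_def]
  exact ENNReal.toReal_mono hf (eLpNorm_indicator_le f)

omit [DecidableEq ι] [NormedSpace ℝ F₁] [NormedSpace ℝ F₂] [NormedSpace ℝ F₃] in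
/-- Domination by a sum of two norms. [folklore] -/
theorem l2On_le_add_of_norm_le {K : Set (EuclideanSpace ℝ ι)} (hK : IsCompact K)
    {h : EuclideanSpace ℝ ι → F₃} {f : EuclideanSpace ℝ ι → F₁} {g : EuclideanSpace ℝ ι → F₂}
    (hf : Continuous f) (hg : Continuous g) (hle : ∀ x ∈ K, ‖h x‖ ≤ ‖f x‖ + ‖g x‖) :
    l2On K h ≤ l2On K f + l2On K g := by
  have h1 : l2On K h ≤ 1 * l2On K (fun x => ‖f x‖ + ‖g x‖) :=
    l2On_le_mul_of_le hK (g := fun x => ‖f x‖ + ‖g x‖) (hf.norm.add hg.norm) zero_le_one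
      fun x hx => by
        rw [one_mul, Real.norm_of_nonneg (add_nonneg (norm_nonneg (f x)) (norm_nonneg (g x)))]
        exact hle x hx
  rw [one_mul] at h1
  refine h1.trans ((l2On_add_le hK (f := fun x => ‖f x‖) (g := fun x => ‖g x‖) hf.norm
    hg.norm).trans_eq ?_)
  rw [l2On_norm, l2On_norm]

omit [DecidableEq ι] [NormedSpace ℝ F] in
/-- `l2On` is subadditive over finite sums of continuous maps. [folklore] -/
theorem l2On_finset_sum_le {K : Set (EuclideanSpace ℝ ι)} (hK : IsCompact K) {κ : Type*}
    (S : Finset κ) {φ : κ → EuclideanSpace ℝ ι → F} (hφ : ∀ k ∈ S, Continuous (φ k)) :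
    l2On K (fun x => ∑ k ∈ S, φ k x) ≤ ∑ k ∈ S, l2On K (φ k) := by
  classical
  induction S using Finset.induction_on with
  | empty => simp
  | insert a S ha ih =>
    have hS : ∀ k ∈ S, Continuous (φ k) := fun k hk => hφ k (Finset.mem_insert_of_mem hk)
    simp only [Finset.sum_insert ha]
    refine (l2On_add_le hK (hφ a (Finset.mem_insert_self a S))
      (continuous_finsetSum _ fun k hk => hS k hk)).trans ?_
    gcongr
    exact ih hS

/-! ### The control predicate -/

/-- **sup/`L²` control of word derivatives on `K`**: `g` is smooth, `‖∂_c g(x)‖ ≤ A` for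
`x ∈ K`, `|c| ≤ q`, and `‖∂_c g‖_{L²(K)} ≤ Y` for `|c| ≤ m`.
[cite: TaylorPDEIII2011, Ch. 13, §3] -/
structure Ctrl (K : Set (EuclideanSpace ℝ ι)) (q m : ℕ) (A Y : ℝ) (g : EuclideanSpace ℝ ι → F) :
    Prop where
  smooth : ContDiff ℝ ∞ g
  sup : ∀ c : List ι, c.length ≤ q → ∀ x ∈ K, ‖cwd c g x‖ ≤ A
  l2 : ∀ c : List ι, c.length ≤ m → l2On K (cwd c g) ≤ Y

namespace Ctrl

variable {K : Set (EuclideanSpace ℝ ι)} {q m : ℕ} {A Y A' Y' : ℝ}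
variable {g f : EuclideanSpace ℝ ι → F}

omit [DecidableEq ι] in
/-- The `L²` bound is nonnegative. [folklore] -/
theorem Y_nonneg (h : Ctrl K q m A Y g) : 0 ≤ Y :=
  (l2On_nonneg K (cwd [] g)).trans (h.l2 [] (by simp))

omit [DecidableEq ι] in
/-- The sup bound is nonnegative as soon as `K` is nonempty. [folklore] -/
theorem A_nonneg (h : Ctrl K q m A Y g) (hK : K.Nonempty) : 0 ≤ A := by
  obtain ⟨x, hx⟩ := hK
  exact (norm_nonneg _).trans (h.sup [] (by simp) x hx)

omit [DecidableEq ι] in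
/-- Monotonicity in all parameters. [folklore] -/
theorem mono (h : Ctrl K q m A Y g) {q' m' : ℕ} (hq : q' ≤ q) (hm : m' ≤ m) (hA : A ≤ A')
    (hY : Y ≤ Y') : Ctrl K q' m' A' Y' g :=
  ⟨h.smooth, fun c hc x hx => (h.sup c (hc.trans hq) x hx).trans hA,
    fun c hc => (h.l2 c (hc.trans hm)).trans hY⟩

omit [DecidableEq ι] in
/-- Control of a word derivative, with the orders shifted. [folklore] -/
theorem cwd_right (c : List ι) (h : Ctrl K (q + c.length) (m + c.length) A Y g) :
    Ctrl K q m A Y (cwd c g) := by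
  refine ⟨contDiff_cwd h.smooth c, fun c' hc' x hx => ?_, fun c' hc' => ?_⟩
  · rw [← cwd_append]
    exact h.sup (c' ++ c) (by simp; omega) x hx
  · rw [← cwd_append]
    exact h.l2 (c' ++ c) (by simp; omega)

omit [DecidableEq ι] in
/-- Sums. [folklore] -/
theorem add (hK : IsCompact K) (hf : Ctrl K q m A Y f) (hg : Ctrl K q m A' Y' g) :
    Ctrl K q m (A + A') (Y + Y') (fun x => f x + g x) := by
  refine ⟨hf.smooth.add hg.smooth, fun c hc x hx => ?_, fun c hc => ?_⟩
  · rw [cwd_fun_add hf.smooth hg.smooth]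
    exact (norm_add_le _ _).trans (add_le_add (hf.sup c hc x hx) (hg.sup c hc x hx))
  · rw [cwd_fun_add hf.smooth hg.smooth]
    exact (l2On_add_le hK (continuous_cwd hf.smooth c) (continuous_cwd hg.smooth c)).trans
      (add_le_add (hf.l2 c hc) (hg.l2 c hc))

omit [DecidableEq ι] in
/-- Differences. [folklore] -/
theorem sub (hK : IsCompact K) (hf : Ctrl K q m A Y f) (hg : Ctrl K q m A' Y' g) :
    Ctrl K q m (A + A') (Y + Y') (fun x => f x - g x) := by
  refine ⟨hf.smooth.sub hg.smooth, fun c hc x hx => ?_, fun c hc => ?_⟩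
  · rw [cwd_fun_sub hf.smooth hg.smooth]
    exact (norm_sub_le _ _).trans (add_le_add (hf.sup c hc x hx) (hg.sup c hc x hx))
  · rw [cwd_fun_sub hf.smooth hg.smooth]
    have h1 : l2On K (fun x => cwd c f x - cwd c g x) ≤ l2On K (cwd c f) + l2On K (cwd c g) :=
      l2On_le_add_of_norm_le hK (continuous_cwd hf.smooth c) (continuous_cwd hg.smooth c)
        fun x _ => norm_sub_le _ _
    exact h1.trans (add_le_add (hf.l2 c hc) (hg.l2 c hc))

omit [DecidableEq ι] in
/-- Finite sums. [folklore] -/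
theorem sum (hK : IsCompact K) {κ : Type*} (S : Finset κ) {φ : κ → EuclideanSpace ℝ ι → F}
    {A Y : κ → ℝ} (h : ∀ k ∈ S, Ctrl K q m (A k) (Y k) (φ k)) :
    Ctrl K q m (∑ k ∈ S, A k) (∑ k ∈ S, Y k) (fun x => ∑ k ∈ S, φ k x) := by
  have hsm : ∀ k ∈ S, ContDiff ℝ ∞ (φ k) := fun k hk => (h k hk).smooth
  refine ⟨ContDiff.sum hsm, fun c hc x hx => ?_, fun c hc => ?_⟩
  · rw [cwd_finset_sum S hsm]
    exact (norm_sum_le _ _).trans (Finset.sum_le_sum fun k hk => (h k hk).sup c hc x hx)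
  · rw [cwd_finset_sum S hsm]
    exact (l2On_finset_sum_le hK S fun k hk => continuous_cwd (hsm k hk) c).trans
      (Finset.sum_le_sum fun k hk => (h k hk).l2 c hc)

omit [DecidableEq ι] in
/-- Constants. [folklore] -/
theorem const (hK : IsCompact K) (c₀ : F) (q m : ℕ) :
    Ctrl K q m ‖c₀‖ (((volume K) ^ (2 : ℝ)⁻¹).toReal * ‖c₀‖) (fun _ : EuclideanSpace ℝ ι => c₀) := by
  have hval : ∀ c : List ι, ∀ x, ‖cwd c (fun _ : EuclideanSpace ℝ ι => c₀) x‖ ≤ ‖c₀‖ := by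
    intro c x
    by_cases hc : c = []
    · subst hc; simp
    · rw [cwd_const_of_ne_nil c₀ hc]; simp
  exact ⟨contDiff_const, fun c _ x _ => hval c x,
    fun c _ => l2On_le_of_bound hK (norm_nonneg _) fun x _ => hval c x⟩

omit [DecidableEq ι] in
/-- Post-composition with a continuous linear map. [folklore] -/
theorem clm_comp (hK : IsCompact K) (L : F →L[ℝ] F₃) (h : Ctrl K q m A Y g) :
    Ctrl K q m (‖L‖ * A) (‖L‖ * Y) (fun x => L (g x)) := by
  refine ⟨L.contDiff.comp h.smooth, fun c hc x hx => ?_, fun c hc => ?_⟩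
  · rw [cwd_clm_comp L h.smooth]
    exact (L.le_opNorm _).trans (mul_le_mul_of_nonneg_left (h.sup c hc x hx) (norm_nonneg _))
  · rw [cwd_clm_comp L h.smooth]
    exact (l2On_le_mul_of_le hK (continuous_cwd h.smooth c) (norm_nonneg L)
      fun x _ => L.le_opNorm _).trans (mul_le_mul_of_nonneg_left (h.l2 c hc) (norm_nonneg _))

omit [DecidableEq ι] in
/-- **Tame product estimate.** For a continuous bilinear `B` and `m ≤ 2q + 1`: in every term
`B(∂_{c₁} f, ∂_{c₂} g)` of the Leibniz expansion of `∂_c B(f, g)`, `|c| ≤ m`, one of the two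
words has length `≤ q`, so that factor is bounded in sup norm and the other in `L²(K)`.
[cite: TaylorPDEIII2011, Ch. 13, §3, Prop. 3.7] -/
theorem bilinear (B : F₁ →L[ℝ] F₂ →L[ℝ] F₃) (hK : IsCompact K) {f : EuclideanSpace ℝ ι → F₁}
    {g : EuclideanSpace ℝ ι → F₂} (hf : Ctrl K q m A Y f) (hg : Ctrl K q m A' Y' g)
    (hA : 0 ≤ A) (hA' : 0 ≤ A') (hqm : m ≤ 2 * q + 1) :
    Ctrl K q m (2 ^ q * (‖B‖ * A * A')) (2 ^ m * (‖B‖ * (A * Y' + A' * Y)))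
      (fun x => B (f x) (g x)) := by
  have hY := hf.Y_nonneg
  have hY' := hg.Y_nonneg
  refine ⟨contDiff_bilinear_apply B hf.smooth hg.smooth, fun c hc x hx => ?_, fun c hc => ?_⟩
  · rw [cwd_bilinear B hf.smooth hg.smooth c]
    refine (norm_list_sum_le _).trans ?_
    rw [List.map_map]
    have hterm : ∀ p ∈ splittings c, ‖B (cwd p.1 f x) (cwd p.2 g x)‖ ≤ ‖B‖ * A * A' := by
      intro p hp
      have hl := length_add_length_of_mem_splittings hp
      refine (B.le_opNorm₂ _ _).trans ?_
      have h1 := hf.sup p.1 (by omega) x hx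
      have h2 := hg.sup p.2 (by omega) x hx
      exact mul_le_mul (mul_le_mul_of_nonneg_left h1 (norm_nonneg B)) h2 (norm_nonneg _)
        (by positivity)
    calc ((splittings c).map ((fun y => ‖y‖) ∘ fun p => B (cwd p.1 f x) (cwd p.2 g x))).sum
        ≤ ((splittings c).map fun _ => ‖B‖ * A * A').sum :=
          List.sum_le_sum fun p hp => hterm p hp
      _ = (splittings c).length * (‖B‖ * A * A') := by
          rw [List.map_const', List.sum_replicate, nsmul_eq_mul]
      _ ≤ 2 ^ q * (‖B‖ * A * A') := by
          rw [length_splittings]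
          push_cast
          exact mul_le_mul_of_nonneg_right (pow_le_pow_right₀ (by norm_num) hc) (by positivity)
  · rw [cwd_bilinear B hf.smooth hg.smooth c]
    have hcont : ∀ p ∈ splittings c, Continuous fun x => B (cwd p.1 f x) (cwd p.2 g x) :=
      fun p _ => (contDiff_bilinear_apply B (contDiff_cwd hf.smooth p.1)
        (contDiff_cwd hg.smooth p.2)).continuous
    refine (l2On_list_sum_le hK (splittings c) hcont).trans ?_
    have hterm : ∀ p ∈ splittings c,
        l2On K (fun x => B (cwd p.1 f x) (cwd p.2 g x)) ≤ ‖B‖ * (A * Y' + A' * Y) := by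
      intro p hp
      have hl := length_add_length_of_mem_splittings hp
      by_cases h1 : p.1.length ≤ q
      · have hb : l2On K (fun x => B (cwd p.1 f x) (cwd p.2 g x)) ≤ ‖B‖ * A * l2On K (cwd p.2 g) :=
          l2On_le_mul_of_le hK (continuous_cwd hg.smooth p.2) (by positivity) fun x hx =>
            (B.le_opNorm₂ _ _).trans (mul_le_mul_of_nonneg_right
              (mul_le_mul_of_nonneg_left (hf.sup p.1 h1 x hx) (norm_nonneg B)) (norm_nonneg _))
        have h2 := hg.l2 p.2 (by omega)
        calc _ ≤ ‖B‖ * A * Y' := hb.trans (mul_le_mul_of_nonneg_left h2 (by positivity))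
          _ ≤ ‖B‖ * (A * Y' + A' * Y) := by
              nlinarith [mul_nonneg (mul_nonneg (norm_nonneg B) hA') hY]
      · have h2 : p.2.length ≤ q := by omega
        have hb : l2On K (fun x => B (cwd p.1 f x) (cwd p.2 g x)) ≤ ‖B‖ * A' * l2On K (cwd p.1 f) :=
          l2On_le_mul_of_le hK (continuous_cwd hf.smooth p.1) (by positivity) fun x hx => by
            calc ‖B (cwd p.1 f x) (cwd p.2 g x)‖ ≤ ‖B‖ * ‖cwd p.1 f x‖ * ‖cwd p.2 g x‖ :=
                  B.le_opNorm₂ _ _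
              _ ≤ ‖B‖ * ‖cwd p.1 f x‖ * A' := mul_le_mul_of_nonneg_left (hg.sup p.2 h2 x hx)
                  (by positivity)
              _ = ‖B‖ * A' * ‖cwd p.1 f x‖ := by ring
        have h3 := hf.l2 p.1 (by omega)
        calc _ ≤ ‖B‖ * A' * Y := hb.trans (mul_le_mul_of_nonneg_left h3 (by positivity))
          _ ≤ ‖B‖ * (A * Y' + A' * Y) := by
              nlinarith [mul_nonneg (mul_nonneg (norm_nonneg B) hA) hY']
    calc ((splittings c).map fun p => l2On K (fun x => B (cwd p.1 f x) (cwd p.2 g x))).sum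
        ≤ ((splittings c).map fun _ => ‖B‖ * (A * Y' + A' * Y)).sum :=
          List.sum_le_sum fun p hp => hterm p hp
      _ = (splittings c).length * (‖B‖ * (A * Y' + A' * Y)) := by
          rw [List.map_const', List.sum_replicate, nsmul_eq_mul]
      _ ≤ 2 ^ m * (‖B‖ * (A * Y' + A' * Y)) := by
          rw [length_splittings]
          push_cast
          exact mul_le_mul_of_nonneg_right (pow_le_pow_right₀ (by norm_num) hc) (by positivity)

omit [DecidableEq ι] in
/-- **Tame product estimate for a scalar factor.** [cite: TaylorPDEIII2011, Ch. 13, §3, Prop. 3.7] -/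
theorem smul (hK : IsCompact K) {a : EuclideanSpace ℝ ι → ℝ} {g : EuclideanSpace ℝ ι → F}
    (ha : Ctrl K q m A Y a) (hg : Ctrl K q m A' Y' g) (hA : 0 ≤ A) (hA' : 0 ≤ A')
    (hqm : m ≤ 2 * q + 1) :
    Ctrl K q m (2 ^ q * (A * A')) (2 ^ m * (A * Y' + A' * Y)) (fun x => a x • g x) := by
  have h := ha.bilinear (ContinuousLinearMap.lsmul ℝ ℝ : ℝ →L[ℝ] F →L[ℝ] F) hK hg hA hA' hqm
  simp only [ContinuousLinearMap.lsmul_apply] at h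
  have hB : ‖(ContinuousLinearMap.lsmul ℝ ℝ : ℝ →L[ℝ] F →L[ℝ] F)‖ ≤ 1 :=
    ContinuousLinearMap.opNorm_lsmul_le
  have hY := ha.Y_nonneg
  have hY' := hg.Y_nonneg
  refine h.mono le_rfl le_rfl ?_ ?_
  · calc 2 ^ q * (‖(ContinuousLinearMap.lsmul ℝ ℝ : ℝ →L[ℝ] F →L[ℝ] F)‖ * A * A')
        ≤ 2 ^ q * (1 * A * A') := by gcongr
      _ = 2 ^ q * (A * A') := by ring
  · calc 2 ^ m * (‖(ContinuousLinearMap.lsmul ℝ ℝ : ℝ →L[ℝ] F →L[ℝ] F)‖ * (A * Y' + A' * Y))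
        ≤ 2 ^ m * (1 * (A * Y' + A' * Y)) := by gcongr
      _ = 2 ^ m * (A * Y' + A' * Y) := by ring

end Ctrl

/-! ### The commutator estimate -/

omit [DecidableEq ι] in
/-- **Commutator estimate.** If `a` is controlled to orders `(qa, n)` and `g` to orders
`(qg, n - 1)` on `K`, with `n ≤ qa + qg + 1`, then for `|v| ≤ n`
`‖∂_v (a g) - a ∂_v g‖_{L²(K)} ≤ 2^n (A_a Y_g + A_g Y_a)`: every remainder term of the Leibniz
expansion carries at least one derivative on `a`, hence at most `n - 1` on `g`.
[cite: TaylorPDEIII2011, Ch. 13, §3, Prop. 3.7 (3.6.21)] -/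
theorem l2On_cwd_smul_sub_le {K : Set (EuclideanSpace ℝ ι)} (hK : IsCompact K)
    {a : EuclideanSpace ℝ ι → ℝ} {g : EuclideanSpace ℝ ι → F} {qa qg n : ℕ} {Aa Ya Ag Yg : ℝ}
    (ha : Ctrl K qa n Aa Ya a) (hg : Ctrl K qg (n - 1) Ag Yg g) (hAa : 0 ≤ Aa) (hAg : 0 ≤ Ag)
    (hn : n ≤ qa + qg + 1) (v : List ι) (hv : v.length ≤ n) :
    l2On K (fun x => cwd v (fun y => a y • g y) x - a x • cwd v g x) ≤ 2 ^ n * (Aa * Yg + Ag * Ya) := by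
  have hYa := ha.Y_nonneg
  have hYg := hg.Y_nonneg
  obtain ⟨r, hr, hne⟩ := splittings_eq_cons v
  have hmem : ∀ p ∈ r, p ∈ splittings v := fun p hp => by rw [hr]; exact List.mem_cons_of_mem _ hp
  have hexp : (fun x => cwd v (fun y => a y • g y) x - a x • cwd v g x) =
      fun x => (r.map fun p => cwd p.1 a x • cwd p.2 g x).sum := by
    funext x
    rw [cwd_smul ha.smooth hg.smooth v, hr]
    simp
  rw [hexp]
  have hcont : ∀ p ∈ r, Continuous fun x => cwd p.1 a x • cwd p.2 g x := fun p _ =>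
    (continuous_cwd ha.smooth p.1).smul (continuous_cwd hg.smooth p.2)
  refine (l2On_list_sum_le hK r hcont).trans ?_
  have hterm : ∀ p ∈ r, l2On K (fun x => cwd p.1 a x • cwd p.2 g x) ≤ Aa * Yg + Ag * Ya := by
    intro p hp
    have hl := length_add_length_of_mem_splittings (hmem p hp)
    have h1 : 1 ≤ p.1.length := by
      rcases Nat.eq_zero_or_pos p.1.length with h | h
      · exact absurd (List.eq_nil_of_length_eq_zero h) (hne p hp)
      · exact h
    by_cases hq : p.1.length ≤ qa
    · have hb : l2On K (fun x => cwd p.1 a x • cwd p.2 g x) ≤ Aa * l2On K (cwd p.2 g) :=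
        l2On_le_mul_of_le hK (continuous_cwd hg.smooth p.2) hAa fun x hx => by
          rw [norm_smul]
          exact mul_le_mul_of_nonneg_right (ha.sup p.1 hq x hx) (norm_nonneg _)
      have h2 := hg.l2 p.2 (by omega)
      nlinarith [mul_le_mul_of_nonneg_left h2 hAa]
    · have h2 : p.2.length ≤ qg := by omega
      have hb : l2On K (fun x => cwd p.1 a x • cwd p.2 g x) ≤ Ag * l2On K (cwd p.1 a) :=
        l2On_le_mul_of_le hK (continuous_cwd ha.smooth p.1) hAg fun x hx => by
          rw [norm_smul, mul_comm]
          exact mul_le_mul_of_nonneg_right (hg.sup p.2 h2 x hx) (norm_nonneg _)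
      have h3 := ha.l2 p.1 (by omega)
      nlinarith [mul_le_mul_of_nonneg_left h3 hAg]
  have hlen : r.length ≤ 2 ^ n := by
    have h := length_splittings v
    rw [hr, List.length_cons] at h
    calc r.length ≤ 2 ^ v.length := by omega
      _ ≤ 2 ^ n := Nat.pow_le_pow_right (by norm_num) hv
  calc (r.map fun p => l2On K (fun x => cwd p.1 a x • cwd p.2 g x)).sum
      ≤ (r.map fun _ => Aa * Yg + Ag * Ya).sum := List.sum_le_sum fun p hp => hterm p hp
    _ = r.length * (Aa * Yg + Ag * Ya) := by rw [List.map_const', List.sum_replicate, nsmul_eq_mul]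
    _ ≤ 2 ^ n * (Aa * Yg + Ag * Ya) := by
        refine mul_le_mul_of_nonneg_right ?_ (by positivity)
        exact_mod_cast hlen

/-! ### Fixed compactly supported maps, compositions, transfers -/

omit [DecidableEq ι] in
/-- Uniform bound for finitely many word derivatives of a smooth compactly supported map.
[folklore] -/
theorem exists_bound_cwd_of_hasCompactSupport' {θ : EuclideanSpace ℝ ι → F} (hθ : ContDiff ℝ ∞ θ)
    (hθc : HasCompactSupport θ) (n : ℕ) :
    ∃ M : ℝ, 0 ≤ M ∧ ∀ a : List ι, a.length ≤ n → ∀ x, ‖cwd a θ x‖ ≤ M := by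
  have hfin : Set.Finite {a : List ι | a.length ≤ n} := List.finite_length_le ι n
  have hb : ∀ a : List ι, ∃ M : ℝ, ∀ x, ‖cwd a θ x‖ ≤ M := fun a =>
    (continuous_cwd hθ a).bounded_above_of_compact_support (hasCompactSupport_cwd hθc a)
  choose M hM using hb
  obtain ⟨M₀, hM₀⟩ := (hfin.image M).bddAbove
  refine ⟨max M₀ 0, le_max_right _ _, fun a ha x => (hM a x).trans ?_⟩
  exact (hM₀ ⟨a, ha, rfl⟩).trans (le_max_left _ _)

omit [DecidableEq ι] in
/-- A fixed smooth compactly supported map is controlled to all orders. [folklore] -/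
theorem exists_ctrl_of_hasCompactSupport {K : Set (EuclideanSpace ℝ ι)} (hK : IsCompact K)
    {θ : EuclideanSpace ℝ ι → F} (hθ : ContDiff ℝ ∞ θ) (hθc : HasCompactSupport θ) (q m : ℕ) :
    ∃ M : ℝ, 0 ≤ M ∧ Ctrl K q m M M θ := by
  obtain ⟨M₁, hM₁0, hM₁⟩ := exists_bound_cwd_of_hasCompactSupport' hθ hθc (max q m)
  refine ⟨M₁ + ((volume K) ^ (2 : ℝ)⁻¹).toReal * M₁, by positivity, hθ, fun c hc x _ => ?_,
    fun c hc => ?_⟩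
  · have := hM₁ c (hc.trans (le_max_left _ _)) x
    have : 0 ≤ ((volume K) ^ (2 : ℝ)⁻¹).toReal * M₁ := by positivity
    linarith
  · have h := l2On_le_of_bound hK hM₁0 fun x _ => hM₁ c (hc.trans (le_max_right _ _)) x
    linarith

section Comp

variable {J : Type u} [NormedAddCommGroup J] [NormedSpace ℝ J] [FiniteDimensional ℝ J]

omit [DecidableEq ι] in
/-- **Tame composition estimate**: for smooth `Φ` and `m/2 + 1 ≤ q` there is `C` (depending on
`Φ`, `K`, `q`, `m`, `A` only) with `Ctrl K q m A Y h → Ctrl K q m C (C(1+Y)) (Φ ∘ (id, h))`.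
[cite: TaylorPDEIII2011, Ch. 13, §3, Prop. 3.9] -/
theorem exists_ctrl_comp {G : Type u} [NormedAddCommGroup G] [NormedSpace ℝ G]
    {Φ : EuclideanSpace ℝ ι × J → G} (hΦ : ContDiff ℝ ∞ Φ) {K : Set (EuclideanSpace ℝ ι)}
    (hK : IsCompact K) (q m : ℕ) (hqm : m / 2 + 1 ≤ q) (A : ℝ) :
    ∃ C : ℝ, 0 ≤ C ∧ ∀ (h : EuclideanSpace ℝ ι → J) (Y : ℝ), Ctrl K q m A Y h →
      Ctrl K q m C (C * (1 + Y)) (fun y => Φ (y, h y)) := by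
  obtain ⟨C₁, hC₁0, hC₁⟩ := exists_sup_bound_cwd_comp (ι := ι) (J := J) q hΦ hK A
  obtain ⟨C₂, hC₂0, hC₂⟩ := exists_tame_bound_cwd_comp (ι := ι) (J := J) m hΦ hK A
  refine ⟨max C₁ C₂, by positivity, fun h Y hh => ⟨contDiff_comp_graph hΦ hh.smooth,
    fun c hc x hx => ?_, fun c hc => ?_⟩⟩
  · exact (hC₁ h hh.smooth (fun c hc => hh.sup c hc) c hc x hx).trans (le_max_left _ _)
  · have hY := hh.Y_nonneg
    refine (hC₂ h hh.smooth (fun c hc => hh.sup c (hc.trans hqm)) Y hY (fun c hc => hh.l2 c hc)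
      c hc).trans ?_
    exact mul_le_mul_of_nonneg_right (le_max_right _ _) (by positivity)

end Comp

omit [DecidableEq ι] in
/-- **Control of chart transfers**: sup bounds of `u` on `τ(tsupport m)` and global `L²` bounds
of `u` give control of `transfer m τ u` on every `K`. [folklore] -/
theorem _root_.Literature.Analysis.PDE.TransferData.exists_ctrl_transfer (D : TransferData ι)
    (q m : ℕ) :
    ∃ C : ℝ, 0 ≤ C ∧ ∀ (K : Set (EuclideanSpace ℝ ι)) (u : EuclideanSpace ℝ ι → F),
      ContDiff ℝ ∞ u → HasCompactSupport u → ∀ A Y : ℝ, 0 ≤ A → 0 ≤ Y →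
      (∀ w : List ι, w.length ≤ q → ∀ y ∈ D.τ '' tsupport D.m, ‖cwd w u y‖ ≤ A) →
      (∀ w : List ι, w.length ≤ m →
        (eLpNorm (cwd w u) 2 (volume : Measure (EuclideanSpace ℝ ι))).toReal ≤ Y) →
      Ctrl K q m (C * A) (C * Y) (transfer D.m D.τ u) := by
  obtain ⟨C₁, hC₁0, hC₁⟩ := D.exists_sup_cwd_transfer_le (F := F) q
  obtain ⟨C₂, hC₂0, hC₂⟩ := D.exists_l2_cwd_transfer_le (F := F) m
  refine ⟨max C₁ C₂, by positivity, fun K u hu huc A Y hA hY hsup hl2 => ⟨D.contDiff_transfer hu,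
    fun c hc x _ => ?_, fun c hc => ?_⟩⟩
  · exact (hC₁ u hu c hc A hA hsup x).trans (mul_le_mul_of_nonneg_right (le_max_left _ _) hA)
  · have htc : HasCompactSupport (transfer D.m D.τ u) :=
      D.hasCompactSupport_m.smul_right (f' := fun x => u (D.τ x))
    have hfin : eLpNorm (cwd c (transfer D.m D.τ u)) 2 (volume : Measure (EuclideanSpace ℝ ι)) ≠ ⊤ :=
      ((continuous_cwd (D.contDiff_transfer hu) c).memLp_of_hasCompactSupport
        (hasCompactSupport_cwd htc c)).eLpNorm_lt_top.ne
    refine (l2On_le_eLpNorm_toReal K hfin).trans ((hC₂ u hu huc c hc Y hY hl2).trans ?_)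
    exact mul_le_mul_of_nonneg_right (le_max_right _ _) hY

/-! ### Normal form of the control -/

/-- **Normal form** `CtrlN K q m C Y g := Ctrl K q m C (C (1 + Y)) g`: one constant `C`
(depending on the data only) and one size parameter `Y` (a top-order Sobolev norm).
[cite: TaylorPDEIII2011, Ch. 13, §3] -/
def CtrlN (K : Set (EuclideanSpace ℝ ι)) (q m : ℕ) (C Y : ℝ) (g : EuclideanSpace ℝ ι → F) : Prop :=
  Ctrl K q m C (C * (1 + Y)) g

namespace CtrlN

variable {K : Set (EuclideanSpace ℝ ι)} {q m : ℕ} {C C₁ C₂ Y A Y' : ℝ}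
variable {g f : EuclideanSpace ℝ ι → F}

omit [DecidableEq ι] in
/-- Unfolding. [folklore] -/
theorem ctrl (h : CtrlN K q m C Y g) : Ctrl K q m C (C * (1 + Y)) g := h

omit [DecidableEq ι] in
/-- Normalisation of a control. [folklore] -/
theorem of_ctrl (h : Ctrl K q m A Y' g) (hA : A ≤ C) (hY : Y' ≤ C * (1 + Y)) : CtrlN K q m C Y g :=
  h.mono le_rfl le_rfl hA hY

omit [DecidableEq ι] in
/-- Normalisation of a control that is linear in `(A, Y)`. [folklore] -/
theorem of_ctrl_lin {c : ℝ} (h : Ctrl K q m (c * A) (c * Y) g) (hc : 0 ≤ c) (hA : 0 ≤ A)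
    (hY : 0 ≤ Y) : CtrlN K q m (c * (A + 1)) Y g := by
  refine of_ctrl h (by nlinarith) ?_
  have : c * Y ≤ c * ((A + 1) * (1 + Y)) := mul_le_mul_of_nonneg_left (by nlinarith) hc
  linarith [this]

omit [DecidableEq ι] in
/-- A control with equal constants is in normal form. [folklore] -/
theorem of_ctrl_const {M : ℝ} (h : Ctrl K q m M M g) (hM : 0 ≤ M) (hY : 0 ≤ Y) :
    CtrlN K q m M Y g :=
  of_ctrl h le_rfl (by nlinarith)

omit [DecidableEq ι] in
/-- Monotonicity in the constant. [folklore] -/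
theorem mono (h : CtrlN K q m C Y g) {C' : ℝ} (hC : C ≤ C') (hY : 0 ≤ Y) : CtrlN K q m C' Y g :=
  of_ctrl h hC (mul_le_mul_of_nonneg_right hC (by linarith))

omit [DecidableEq ι] in
/-- Lower orders. [folklore] -/
theorem mono_order (h : CtrlN K q m C Y g) {q' m' : ℕ} (hq : q' ≤ q) (hm : m' ≤ m) :
    CtrlN K q' m' C Y g :=
  h.ctrl.mono hq hm le_rfl le_rfl

omit [DecidableEq ι] in
/-- Word derivatives. [folklore] -/
theorem cwd_right (c : List ι) (h : CtrlN K (q + c.length) (m + c.length) C Y g) :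
    CtrlN K q m C Y (cwd c g) :=
  Ctrl.cwd_right c h

omit [DecidableEq ι] in
/-- Sums. [folklore] -/
theorem add (hK : IsCompact K) (hf : CtrlN K q m C₁ Y f) (hg : CtrlN K q m C₂ Y g) :
    CtrlN K q m (C₁ + C₂) Y (fun x => f x + g x) :=
  of_ctrl (hf.ctrl.add hK hg.ctrl) le_rfl (by ring_nf; rfl)

omit [DecidableEq ι] in
/-- Differences. [folklore] -/
theorem sub (hK : IsCompact K) (hf : CtrlN K q m C₁ Y f) (hg : CtrlN K q m C₂ Y g) :
    CtrlN K q m (C₁ + C₂) Y (fun x => f x - g x) :=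
  of_ctrl (hf.ctrl.sub hK hg.ctrl) le_rfl (by ring_nf; rfl)

omit [DecidableEq ι] in
/-- Finite sums. [folklore] -/
theorem sum (hK : IsCompact K) {κ : Type*} (S : Finset κ) {φ : κ → EuclideanSpace ℝ ι → F}
    {C : κ → ℝ} (h : ∀ k ∈ S, CtrlN K q m (C k) Y (φ k)) :
    CtrlN K q m (∑ k ∈ S, C k) Y (fun x => ∑ k ∈ S, φ k x) :=
  of_ctrl (Ctrl.sum hK S fun k hk => (h k hk).ctrl) le_rfl (by rw [Finset.sum_mul])

omit [DecidableEq ι] in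
/-- Post-composition with a continuous linear map. [folklore] -/
theorem clm_comp (hK : IsCompact K) (L : F →L[ℝ] F₃) (h : CtrlN K q m C Y g) :
    CtrlN K q m (‖L‖ * C) Y (fun x => L (g x)) :=
  of_ctrl (h.ctrl.clm_comp hK L) le_rfl (by rw [mul_assoc])

omit [DecidableEq ι] in
/-- Constants. [folklore] -/
theorem const (hK : IsCompact K) (c₀ : F) (hY : 0 ≤ Y) :
    CtrlN K q m (‖c₀‖ + ((volume K) ^ (2 : ℝ)⁻¹).toReal * ‖c₀‖) Y
      (fun _ : EuclideanSpace ℝ ι => c₀) := by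
  refine of_ctrl (Ctrl.const hK c₀ q m) ?_ ?_
  · have : 0 ≤ ((volume K) ^ (2 : ℝ)⁻¹).toReal * ‖c₀‖ := by positivity
    linarith
  · have h1 : 0 ≤ ‖c₀‖ + ((volume K) ^ (2 : ℝ)⁻¹).toReal * ‖c₀‖ := by positivity
    nlinarith [norm_nonneg c₀]

omit [DecidableEq ι] in
/-- **Tame product in normal form** (`m ≤ 2q + 1`). [cite: TaylorPDEIII2011, Ch. 13, §3, Prop. 3.7] -/
theorem smul (hK : IsCompact K) {a : EuclideanSpace ℝ ι → ℝ} {g : EuclideanSpace ℝ ι → F}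
    (ha : CtrlN K q m C₁ Y a) (hg : CtrlN K q m C₂ Y g) (h1 : 0 ≤ C₁) (h2 : 0 ≤ C₂)
    (hY : 0 ≤ Y) (hqm : m ≤ 2 * q + 1) :
    CtrlN K q m (2 ^ q * 2 ^ (m + 1) * C₁ * C₂) Y (fun x => a x • g x) := by
  have h := Ctrl.smul hK ha.ctrl hg.ctrl h1 h2 hqm
  refine of_ctrl h ?_ ?_
  · have : (1 : ℝ) ≤ 2 ^ (m + 1) := one_le_pow₀ (by norm_num)
    have : 0 ≤ (2 : ℝ) ^ q * C₁ * C₂ := by positivity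
    nlinarith
  · have hq1 : (1 : ℝ) ≤ 2 ^ q := one_le_pow₀ (by norm_num)
    have e : (2 : ℝ) ^ m * (C₁ * (C₂ * (1 + Y)) + C₂ * (C₁ * (1 + Y))) =
        2 ^ (m + 1) * C₁ * C₂ * (1 + Y) := by ring
    rw [e]
    have : 0 ≤ (2 : ℝ) ^ (m + 1) * C₁ * C₂ * (1 + Y) := by positivity
    nlinarith

end CtrlN

section CompN

variable {J : Type u} [NormedAddCommGroup J] [NormedSpace ℝ J] [FiniteDimensional ℝ J]

omit [DecidableEq ι] in
/-- **Tame composition in normal form** (`m/2 + 1 ≤ q`). [cite: TaylorPDEIII2011, Ch. 13, §3, Prop. 3.9] -/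
theorem exists_ctrlN_comp {G : Type u} [NormedAddCommGroup G] [NormedSpace ℝ G]
    {Φ : EuclideanSpace ℝ ι × J → G} (hΦ : ContDiff ℝ ∞ Φ) {K : Set (EuclideanSpace ℝ ι)}
    (hK : IsCompact K) (q m : ℕ) (hqm : m / 2 + 1 ≤ q) (C₁ : ℝ) :
    ∃ C : ℝ, 0 ≤ C ∧ ∀ (h : EuclideanSpace ℝ ι → J) (Y : ℝ), 0 ≤ Y → CtrlN K q m C₁ Y h →
      CtrlN K q m C Y (fun y => Φ (y, h y)) := by
  obtain ⟨C, hC0, hC⟩ := exists_ctrl_comp hΦ hK q m hqm C₁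
  refine ⟨C * (1 + |C₁|), by positivity, fun h Y hY hh => ?_⟩
  refine CtrlN.of_ctrl (hC h _ hh.ctrl) ?_ ?_
  · have : 0 ≤ C * |C₁| := by positivity
    nlinarith
  · have h1 : C₁ * (1 + Y) ≤ |C₁| * (1 + Y) := mul_le_mul_of_nonneg_right (le_abs_self _) (by linarith)
    have h2 : 1 + C₁ * (1 + Y) ≤ (1 + |C₁|) * (1 + Y) := by nlinarith [abs_nonneg C₁]
    calc C * (1 + C₁ * (1 + Y)) ≤ C * ((1 + |C₁|) * (1 + Y)) := mul_le_mul_of_nonneg_left h2 hC0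
      _ = C * (1 + |C₁|) * (1 + Y) := by ring

end CompN

omit [DecidableEq ι] in
/-- **Chart transfers in normal form.** [folklore] -/
theorem _root_.Literature.Analysis.PDE.TransferData.exists_ctrlN_transfer (D : TransferData ι)
    (q m : ℕ) :
    ∃ C : ℝ, 0 ≤ C ∧ ∀ (K : Set (EuclideanSpace ℝ ι)) (u : EuclideanSpace ℝ ι → F),
      ContDiff ℝ ∞ u → HasCompactSupport u → ∀ A Y : ℝ, 0 ≤ A → 0 ≤ Y →
      (∀ w : List ι, w.length ≤ q → ∀ y ∈ D.τ '' tsupport D.m, ‖cwd w u y‖ ≤ A) →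
      (∀ w : List ι, w.length ≤ m →
        (eLpNorm (cwd w u) 2 (volume : Measure (EuclideanSpace ℝ ι))).toReal ≤ Y) →
      CtrlN K q m (C * (A + 1)) Y (transfer D.m D.τ u) := by
  obtain ⟨C, hC0, hC⟩ := D.exists_ctrl_transfer (F := F) q m
  exact ⟨C, hC0, fun K u hu huc A Y hA hY hsup hl2 =>
    CtrlN.of_ctrl_lin (hC K u hu huc A Y hA hY hsup hl2) hC0 hA hY⟩

end Literature.Analysis.PDE

end
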